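import Literature.NumberTheory.LFunctions.WeilExplicitProofs
import Literature.NumberTheory.LFunctions.WeilMellinInversion
import Literature.NumberTheory.LFunctions.WeilArchimedeanPositivityProofs

/-!
# Modulated tests and the shifted identity for window traces

Negative-side support for crux `SpectralTrace.WindowTracePrime2` (stmt-RiemannHypothesis-11196;
cdisprove seat refuter-cdisprove-stmt-RiemannHypothesis-11196-0), first engine of the local
counting law for witnesses (`Negative/ArchBound.lean`, `Negative/LocalCounts.lean`).

* modulated tests `k_T(t) = k(t) e^{-iTt}` (written inline, no definition);
  `weilMellin_modulate`: `k̂_T(s) = k̂(s − iT)` (modulation in `t` is a vertical shift).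
* `hasSum_norm_sq_shift` — **the shifted identity**: if a real family `γ` realises the window
  identity `Trace(A)` (kept INLINE as a hypothesis) and `φ` is a test supported in `[-a, a]`,
  `2a ≤ A`, then for every real `T`, `Σ_i |φ̂(1/2 + i(γ_i − T))|² = Re W(k_T)` with `k = φ ⋆ φ̃`
  (`HasSum`). This is the counting device behind every density statement about witnesses.
* `norm_weilPolarTerm_modulate_le`, `norm_weilPrimeTerm_modulate_le` — the polar and prime terms
  of `W(k_T)` are bounded uniformly in `T` (`2 ∫|k| e^{|t|/2}` and the finite sum
  `Σₙ Λ(n) n^{-1/2}(|k(log n)| + |k(−log n)|)`).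
-/

noncomputable section

open Complex Filter Set MeasureTheory
open scoped Real Topology ArithmeticFunction.vonMangoldt ContDiff

namespace Summit.RiemannHypothesis.RiemannHypothesis.Theorems.WindowTracePrime2.Negative

open Literature.NumberTheory.LFunctions

/-- The character has modulus one: `|k(t) e^{-iTt}| = |k(t)|` (modulated test
`k_T(t) = k(t) e^{-iTt}`, written inline throughout). [folklore] -/
theorem norm_modulate (k : ℝ → ℂ) (T t : ℝ) :
    ‖k t * cexp (((-(T * t) : ℝ) : ℂ) * I)‖ = ‖k t‖ := by
  rw [norm_mul, Complex.norm_exp_ofReal_mul_I, mul_one]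

/-- The character is `1` at `t = 0`. [folklore] -/
theorem modChar_zero (T : ℝ) : cexp (((-(T * 0) : ℝ) : ℂ) * I) = 1 := by
  simp

/-- The character `t ↦ e^{-iTt}` is smooth. [folklore] -/
theorem contDiff_modChar (T : ℝ) : ContDiff ℝ ∞ fun t : ℝ => cexp (((-(T * t) : ℝ) : ℂ) * I) := by
  have h1 : ContDiff ℝ ∞ fun t : ℝ => ((-(T * t) : ℝ) : ℂ) :=
    Complex.ofRealCLM.contDiff.comp ((contDiff_const.mul contDiff_id).neg)
  exact (h1.mul contDiff_const).cexp

/-- Modulated tests are tests. [folklore] -/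
theorem isWeilTest_modulate {k : ℝ → ℂ} (hk : IsWeilTest k) (T : ℝ) :
    IsWeilTest (fun t => k t * cexp (((-(T * t) : ℝ) : ℂ) * I)) :=
  ⟨hk.1.mul (contDiff_modChar T), hk.2.mul_right⟩

/-- Modulation does not enlarge the support. [folklore] -/
theorem tsupport_modulate_subset (k : ℝ → ℂ) (T : ℝ) :
    tsupport (fun t => k t * cexp (((-(T * t) : ℝ) : ℂ) * I)) ⊆ tsupport k :=
  tsupport_mul_subset_left

/-- `k̂_T(s) = k̂(s - iT)`: modulation shifts the transform along vertical lines. -/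
theorem weilMellin_modulate (k : ℝ → ℂ) (T : ℝ) (s : ℂ) :
    weilMellin (fun t => k t * cexp (((-(T * t) : ℝ) : ℂ) * I)) s = weilMellin k (s - T * I) := by
  unfold weilMellin
  congr 1 with t
  beta_reduce
  rw [mul_assoc, ← Complex.exp_add]
  congr 2
  push_cast
  ring

/-- **The shifted identity.** For a witness `γ` of `Trace A` and a test `φ` supported in
`[-a, a]`, `2a ≤ A`: `Σ_i |φ̂(1/2 + i(γ_i - T))|² = Re W(k_T)` with `k = φ ⋆ φ̃`, for every real `T`
(test the identity on the modulated `k_T`, supported in `[-A, A]`; `k̂_T(1/2+iγ) = k̂(1/2+i(γ-T))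
= |φ̂(1/2+i(γ-T))|²`). This is the counting device behind every density statement. -/
theorem hasSum_norm_sq_shift {A : ℝ} {ι : Type} {γ : ι → ℝ}
    (h : (∀ g : ℝ → ℂ, IsWeilTest g → tsupport g ⊆ Set.Icc (-A) A →
        HasSum (fun i => weilMellin g (1 / 2 + (γ i : ℂ) * Complex.I)) (weilFunctional g)))
    {φ : ℝ → ℂ} (hφ : IsWeilTest φ) {a : ℝ} (hφs : tsupport φ ⊆ Set.Icc (-a) a) (h2a : 2 * a ≤ A)
    (T : ℝ) :
    HasSum (fun i => ‖weilMellin φ (1 / 2 + ((γ i - T : ℝ) : ℂ) * I)‖ ^ 2)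
      (weilFunctional ((fun t => weilConv φ (weilReflect φ) t * cexp (((-(T * t) : ℝ) : ℂ) * I)))).re := by
  have hk : IsWeilTest (weilConv φ (weilReflect φ)) := hφ.weilConv hφ.weilReflect
  have hks : tsupport (weilConv φ (weilReflect φ)) ⊆ Set.Icc (-A) A :=
    (tsupport_weilConv_weilReflect_subset hφ.2 hφs).trans
      (Set.Icc_subset_Icc (by linarith) (by linarith))
  have hs := h _ (isWeilTest_modulate hk T) ((tsupport_modulate_subset _ T).trans hks)
  have key : ∀ i, (weilMellin ((fun t => weilConv φ (weilReflect φ) t * cexp (((-(T * t) : ℝ) : ℂ) * I)))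
      (1 / 2 + (γ i : ℂ) * Complex.I)).re = ‖weilMellin φ (1 / 2 + ((γ i - T : ℝ) : ℂ) * I)‖ ^ 2 := by
    intro i
    rw [weilMellin_modulate, show (1 / 2 : ℂ) + (γ i : ℂ) * Complex.I - T * I =
        1 / 2 + ((γ i - T : ℝ) : ℂ) * I by push_cast; ring,
      weilMellin_weilQuadratic_of_re_eq hφ (by simp), Complex.ofReal_re, Complex.normSq_eq_norm_sq]
  exact (Complex.hasSum_re hs).congr_fun fun i => (key i).symm

/-! ### `T`-independent bounds for the polar and prime terms of `W(k_T)` -/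

/-- `|k̂_T(0) + k̂_T(1)| ≤ 2 ∫ |k| e^{|t|/2}`. -/
theorem norm_weilPolarTerm_modulate_le {k : ℝ → ℂ} (hk : IsWeilTest k) (T : ℝ) :
    ‖weilPolarTerm ((fun t => k t * cexp (((-(T * t) : ℝ) : ℂ) * I)))‖ ≤ 2 * weilL1W (1 / 2) k := by
  unfold weilPolarTerm
  rw [weilMellin_modulate, weilMellin_modulate]
  have h0 : ‖weilMellin k (0 - T * I)‖ ≤ weilL1W (1 / 2) k :=
    norm_weilMellin_le_weilL1W hk.1.continuous hk.2 (by norm_num [abs_of_nonneg])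
  have h1 : ‖weilMellin k (1 - T * I)‖ ≤ weilL1W (1 / 2) k :=
    norm_weilMellin_le_weilL1W hk.1.continuous hk.2 (by norm_num [abs_of_nonneg])
  calc ‖weilMellin k (0 - T * I) + weilMellin k (1 - T * I)‖
      ≤ ‖weilMellin k (0 - T * I)‖ + ‖weilMellin k (1 - T * I)‖ := norm_add_le _ _
    _ ≤ 2 * weilL1W (1 / 2) k := by linarith

/-- The majorant is a finite sum (compact support). [folklore] -/
theorem summable_primeMajorant {k : ℝ → ℂ} (hk : HasCompactSupport k) :
    Summable fun n : ℕ => ‖((Λ n : ℝ) : ℂ) / (Real.sqrt n : ℂ)‖ * (‖k (Real.log n)‖ + ‖k (-Real.log n)‖) := by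
  obtain ⟨R, hR⟩ := hk.isCompact.isBounded.subset_closedBall 0
  refine summable_of_ne_finset_zero (s := Finset.range ⌈Real.exp (|R| + 1)⌉₊) fun n hn => ?_
  rw [Finset.mem_range, not_lt] at hn
  have hn' : Real.exp (|R| + 1) ≤ n := (Nat.le_ceil _).trans (by exact_mod_cast hn)
  have hpos : (0 : ℝ) < n := (Real.exp_pos _).trans_le hn'
  have hlog : |R| + 1 ≤ Real.log n := by rwa [Real.le_log_iff_exp_le hpos]
  have h0 : ∀ x : ℝ, |R| < |x| → k x = 0 := fun x hx =>
    image_eq_zero_of_notMem_tsupport fun hxs => by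
      have hxR := hR hxs
      rw [Metric.mem_closedBall, dist_zero_right, Real.norm_eq_abs] at hxR
      linarith [le_abs_self R]
  have h1 : |R| < |Real.log n| := lt_of_lt_of_le (by linarith) (le_abs_self _)
  rw [h0 _ h1, h0 _ (by rwa [abs_neg]), norm_zero, add_zero, mul_zero]

/-- The majorant is non-negative. [folklore] -/
theorem primeMajorant_nonneg (k : ℝ → ℂ) : 0 ≤ (∑' n : ℕ, ‖((Λ n : ℝ) : ℂ) / (Real.sqrt n : ℂ)‖ * (‖k (Real.log n)‖ + ‖k (-Real.log n)‖)) :=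
  tsum_nonneg fun _ => by positivity

/-- `|prime term of k_T| ≤ (∑' n : ℕ, ‖((Λ n : ℝ) : ℂ) / (Real.sqrt n : ℂ)‖ * (‖k (Real.log n)‖ + ‖k (-Real.log n)‖))` (the character has modulus one). -/
theorem norm_weilPrimeTerm_modulate_le {k : ℝ → ℂ} (hk : HasCompactSupport k) (T : ℝ) :
    ‖weilPrimeTerm (fun t => k t * cexp (((-(T * t) : ℝ) : ℂ) * I))‖ ≤
      (∑' n : ℕ, ‖((Λ n : ℝ) : ℂ) / (Real.sqrt n : ℂ)‖ * (‖k (Real.log n)‖ + ‖k (-Real.log n)‖)) := by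
  have hterm : ∀ n : ℕ, ‖((Λ n : ℝ) : ℂ) / (Real.sqrt n : ℂ) *
      (k (Real.log n) * cexp (((-(T * Real.log n) : ℝ) : ℂ) * I) +
        k (-Real.log n) * cexp (((-(T * -Real.log n) : ℝ) : ℂ) * I))‖ ≤
      ‖((Λ n : ℝ) : ℂ) / (Real.sqrt n : ℂ)‖ * (‖k (Real.log n)‖ + ‖k (-Real.log n)‖) := by
    intro n
    rw [norm_mul]
    refine mul_le_mul_of_nonneg_left ?_ (norm_nonneg _)
    calc ‖k (Real.log n) * cexp (((-(T * Real.log n) : ℝ) : ℂ) * I) +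
          k (-Real.log n) * cexp (((-(T * -Real.log n) : ℝ) : ℂ) * I)‖
        ≤ ‖k (Real.log n) * cexp (((-(T * Real.log n) : ℝ) : ℂ) * I)‖ +
          ‖k (-Real.log n) * cexp (((-(T * -Real.log n) : ℝ) : ℂ) * I)‖ := norm_add_le _ _
      _ = ‖k (Real.log n)‖ + ‖k (-Real.log n)‖ := by rw [norm_modulate, norm_modulate]
  have hs : Summable fun n : ℕ => ‖((Λ n : ℝ) : ℂ) / (Real.sqrt n : ℂ) *
      (k (Real.log n) * cexp (((-(T * Real.log n) : ℝ) : ℂ) * I) +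
        k (-Real.log n) * cexp (((-(T * -Real.log n) : ℝ) : ℂ) * I))‖ :=
    Summable.of_nonneg_of_le (fun _ => norm_nonneg _) hterm (summable_primeMajorant hk)
  unfold weilPrimeTerm
  beta_reduce
  exact (norm_tsum_le_tsum_norm hs).trans (hs.tsum_le_tsum hterm (summable_primeMajorant hk))

end Summit.RiemannHypothesis.RiemannHypothesis.Theorems.WindowTracePrime2.Negative

end
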